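import Summits.CriticalPhenomena.PercolationContinuityZ3.Theorems.PercNearOneGluingNoHeavyLowerTailQuantitativeCshIsolatedFloor
import Summits.CriticalPhenomena.PercolationContinuityZ3.Theorems.PercNearOneGluingNoHeavyLowerTailQuantitativeHarrisInfluenceFloor
import Summits.CriticalPhenomena.PercolationContinuityZ3.Theorems.PercNearOneGluingNoHeavyLowerTailQuantitativeCshMarginPositive
import HarnessLib

/-!
# CSH(Y; x; []; o, v) is STRICT for an ARBITRARY monotone functional under the common-pivotal-pair criterion (row M2-R36 ⟸)

Support file (`--supports stmt-CriticalPhenomena-4575`), prover seat `prim-rate-mine-2` (lane prim-rate, constants-miner (c), BENCH row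
M2-R36; `run/shared/lean/prim/prim-rate/prim-rate-mine-2/PROOFS.md` §P38).  No definitions, no named facts, no sorries; standard axioms.

Row M2-R19's strictness direction (`CSH.cshMargin_nil_pos_of_exists_pivotal`) is stated for the connection functional `1{b ∈ C_x}`.  THIS FILE is
the same for EVERY monotone nonnegative functional `f` of the open edge cluster of the owner: weights non-degenerate on the support `E`, `x ∉ Y`,
`o, v ∉ {x} ∪ Y`, `o ≠ v`, `E_Y = {f ∈ E : f ∩ Y = ∅}`; if some `e ∈ E_Y` is pivotal inside `E_Y` both for `f` (a configuration `η ⊆ E_Y` with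
`f(𝒞_x(η ∪ e)) > f(𝒞_x(η ∖ e))`, so `f(𝒞_x(η ∪ e)) ≠ f(𝒞_x(η ∖ e))`) and for `U = {o↔x} ∪ {o↔v}`, then `0 < cshMargin w x Y [] o v f`
(`CSH.cshMargin_nil_pos_of_exists_pivotal_fun`).  Proof: every factor of the explicit isolated influence floor
`CSH.cshMargin_nil_ge_isolated_influenceFloor` (row M2-R20) at `e` is positive.
[cite: VandenbergHaggstromKahn2005, §2.1 (pp. 9–13)] [cite: Harris1960, Lemma 4.1 (p. 16)]
-/

noncomputable section

namespace Summit.CriticalPhenomena.PercolationContinuityZ3.Theorems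

open MeasureTheory Set Literature.Probability.LatticeModels Literature.Probability.Percolation
open Literature.Probability.Percolation.BHK2006 (weight weight_nonneg integral_prodBernoulli_eq_sum)
open scoped Classical

namespace CSH

variable {V : Type*} [Fintype V]

/-- **CSH(Y; x; []; o, v) is strict for a monotone `f ≥ 0` under the common-pivotal-pair criterion.**  Weights non-degenerate on `E`; `x ∉ Y`;
`o, v ∉ {x} ∪ Y`; `o ≠ v`; `E_Y = {f ∈ E : f ∩ Y = ∅}`.  If some `e ∈ E_Y` has a configuration `η ⊆ E_Y` with `f(𝒞_x(η ∪ e)) ≠ f(𝒞_x(η ∖ e))` and a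
configuration `η' ⊆ E_Y` at which it is pivotal for `{o↔x} ∪ {o↔v}`, then `0 < cshMargin w x Y [] o v f`.  Row M2-R36 (⟸).
[cite: VandenbergHaggstromKahn2005, §2.1 (pp. 9–13)] [cite: Harris1960, Lemma 4.1 (p. 16)] -/
theorem cshMargin_nil_pos_of_exists_pivotal_fun (w : Sym2 V → unitInterval) (E : Set (Sym2 V))
    (hE0 : ∀ f, f ∉ E → (w f : ℝ) = 0) (hE1 : ∀ f ∈ E, 0 < (w f : ℝ) ∧ (w f : ℝ) < 1)
    (x : V) (Y : Set V) (o v : V) (hxY : x ∉ Y) (hox : o ≠ x) (hvx : v ≠ x) (hoY : o ∉ Y) (hvY : v ∉ Y) (hov : o ≠ v)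
    (f : Set (Sym2 V) → ℝ) (hf : Monotone f) (hf0 : ∀ C, 0 ≤ f C)
    (hcrit : ∃ e ∈ E, (∀ y ∈ Y, y ∉ e) ∧
      (∃ η : Set (Sym2 V), η ⊆ {f | f ∈ E ∧ ∀ y ∈ Y, y ∉ f} ∧
        f (openEdgeCluster (insert e η) x) ≠ f (openEdgeCluster (η \ {e}) x)) ∧
      (∃ η : Set (Sym2 V), η ⊆ {f | f ∈ E ∧ ∀ y ∈ Y, y ∉ f} ∧ insert e η ∈ (openConn o x ∪ openConn o v : Set (BondConfig V)) ∧
        η \ {e} ∉ (openConn o x ∪ openConn o v : Set (BondConfig V)))) :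
    0 < cshMargin w x Y [] o v f := by
  set μ := prodBernoulli w with hμ
  set D₀ : Set (BondConfig V) := {ω : BondConfig V | ∀ y ∈ Y, ¬ (openGraph ω).Reachable x y} with hD₀
  set U : Set (BondConfig V) := (⋃ t ∈ ({x} : Finset V), openConn o t) ∪ openConn o v with hU
  set EY : Set (Sym2 V) := {f | f ∈ E ∧ ∀ y ∈ Y, y ∉ f} with hEY
  set qY : Sym2 V → unitInterval := fun e' => if (∃ y ∈ Y, y ∈ e') then (0 : unitInterval) else w e' with hqY
  have hmeas : ∀ S : Set (BondConfig V), MeasurableSet S := fun _ => MeasurableSet.of_discrete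
  have hw1r : ∀ e, (w e : ℝ) < 1 := by
    intro e
    by_cases he : e ∈ E
    · exact (hE1 e he).2
    · rw [hE0 e he]; norm_num
  have hw : ∀ e, w e < 1 := fun e => by
    have h := hw1r e
    exact Subtype.coe_lt_coe.1 (by simpa using h)
  have hU' : U = (openConn o x ∪ openConn o v : Set (BondConfig V)) := by
    simp only [hU, Finset.mem_singleton, Set.iUnion_iUnion_eq_left]
  obtain ⟨e, heE, heY, ⟨η₁, hη₁, hne⟩, ⟨η₂, hη₂, hU1, hU2⟩⟩ := hcrit
  -- the floor at `e`
  have hfloor := cshMargin_nil_ge_isolated_influenceFloor w hw x Y o v hxY hox hvx hoY hvY hov f hf hf0 e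
  rw [← hμ, ← hD₀] at hfloor
  -- the zeroed weights: `0` off `E_Y`, `= w ∈ (0,1)` on `E_Y`
  have hq0 : ∀ e', e' ∉ EY → ((qY e' : unitInterval) : ℝ) = 0 := by
    intro e' he'
    simp only [hqY]
    by_cases hc : ∃ y ∈ Y, y ∈ e'
    · rw [if_pos hc]; rfl
    · rw [if_neg hc]
      exact hE0 e' fun heE' => he' ⟨heE', fun y hy hye => hc ⟨y, hy, hye⟩⟩
  have hq1 : ∀ e' ∈ EY, 0 < ((qY e' : unitInterval) : ℝ) ∧ ((qY e' : unitInterval) : ℝ) < 1 := by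
    intro e' he'
    have hc : ¬ ∃ y ∈ Y, y ∈ e' := fun ⟨y, hy, hye⟩ => he'.2 y hy hye
    simp only [hqY]
    rw [if_neg hc]
    exact hE1 e' he'.1
  have hqe : ((qY e : unitInterval) : ℝ) = w e := by
    have hc : ¬ ∃ y ∈ Y, y ∈ e := fun ⟨y, hy, hye⟩ => heY y hy hye
    simp only [hqY]
    rw [if_neg hc]
  -- factor 1: `μ(D₀) > 0`
  have h1 : 0 < μ.real D₀ := QuantHarris.real_pos_of_mem w E hE0 hE1 D₀ ∅ (Set.empty_subset E) (empty_mem_avoidEvent x Y hxY)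
  -- factor 2: the product of `1 − w` over the pairs meeting `Y`
  have h2 : 0 < ∏ e' ∈ Finset.univ.filter (fun e' : Sym2 V => ∃ y ∈ Y, y ∈ e'), (1 - (w e' : ℝ)) :=
    Finset.prod_pos fun e' _ => by linarith [hw1r e']
  -- factor 3: `w(e)(1 − w(e))`
  have h3 : 0 < ((qY e : unitInterval) : ℝ) * (1 - ((qY e : unitInterval) : ℝ)) := by
    rw [hqe]
    exact mul_pos (hE1 e heE).1 (by linarith [(hE1 e heE).2])
  -- factor 4: the influence of `e` on `f`
  have hq0' : ∀ e', 0 ≤ ((qY e' : unitInterval) : ℝ) := fun e' => (qY e').2.1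
  have hq1' : ∀ e', ((qY e' : unitInterval) : ℝ) ≤ 1 := fun e' => (qY e').2.2
  have hΔ0 : ∀ η : BondConfig V, 0 ≤ f (openEdgeCluster (insert e η) x) - f (openEdgeCluster (η \ {e}) x) := fun η =>
    sub_nonneg.2 (hf (BHK2006.openEdgeCluster_mono (Set.sdiff_subset.trans (Set.subset_insert e η)) x))
  have hΔ1 : 0 < f (openEdgeCluster (insert e η₁) x) - f (openEdgeCluster (η₁ \ {e}) x) :=
    lt_of_le_of_ne (hΔ0 η₁) (fun h => hne (sub_eq_zero.1 h.symm))
  have hqlt1 : ∀ e', ((qY e' : unitInterval) : ℝ) < 1 := by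
    intro e'
    simp only [hqY]
    by_cases hc : ∃ y ∈ Y, y ∈ e'
    · rw [if_pos hc]; norm_num
    · rw [if_neg hc]; exact hw1r e'
  have hwη₁ : 0 < weight (fun e' => ((qY e' : unitInterval) : ℝ)) η₁ := by
    refine Finset.prod_pos fun e' _ => ?_
    split_ifs with he'
    · exact (hq1 e' (hη₁ he')).1
    · linarith [hqlt1 e']
  have h4 : 0 < ∫ η, (f (openEdgeCluster (insert e η) x) - f (openEdgeCluster (η \ {e}) x)) ∂(prodBernoulli qY) := by
    rw [integral_prodBernoulli_eq_sum]
    have hterm : ∀ η, 0 ≤ weight (fun e' => ((qY e' : unitInterval) : ℝ)) η *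
        (f (openEdgeCluster (insert e η) x) - f (openEdgeCluster (η \ {e}) x)) := fun η =>
      mul_nonneg (weight_nonneg hq0' hq1' η) (hΔ0 η)
    have hle : weight (fun e' => ((qY e' : unitInterval) : ℝ)) η₁ *
        (f (openEdgeCluster (insert e η₁) x) - f (openEdgeCluster (η₁ \ {e}) x)) ≤
        ∑ η, weight (fun e' => ((qY e' : unitInterval) : ℝ)) η * (f (openEdgeCluster (insert e η) x) - f (openEdgeCluster (η \ {e}) x)) :=
      Finset.single_le_sum (fun η _ => hterm η) (Finset.mem_univ _)
    have hpos : 0 < weight (fun e' => ((qY e' : unitInterval) : ℝ)) η₁ *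
        (f (openEdgeCluster (insert e η₁) x) - f (openEdgeCluster (η₁ \ {e}) x)) := mul_pos hwη₁ hΔ1
    linarith
  -- factor 5: the probability that `e` is pivotal for `U`
  have h5 : 0 < (prodBernoulli qY).real {η : BondConfig V | insert e η ∈ U ∧ η \ {e} ∉ U} := by
    refine QuantHarris.real_pos_of_mem qY EY hq0 hq1 _ η₂ hη₂ ?_
    rw [hU']
    exact ⟨hU1, hU2⟩
  have hprod := mul_pos h1 (mul_pos h2 (mul_pos h3 (mul_pos h4 h5)))
  have key : μ.real D₀ * ((∏ e' ∈ Finset.univ.filter (fun e' : Sym2 V => ∃ y ∈ Y, y ∈ e'), (1 - (w e' : ℝ))) *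
      ((((qY e : unitInterval) : ℝ) * (1 - ((qY e : unitInterval) : ℝ))) *
        ((∫ η, (f (openEdgeCluster (insert e η) x) - f (openEdgeCluster (η \ {e}) x)) ∂(prodBernoulli qY)) *
          (prodBernoulli qY).real {η : BondConfig V | insert e η ∈ U ∧ η \ {e} ∉ U}))) ≤ cshMargin w x Y [] o v f := hfloor
  linarith

end CSH

end Summit.CriticalPhenomena.PercolationContinuityZ3.Theorems

end
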